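import Summits.ResolutionOfSingularities.ResolutionOfSingularities.Theorems.HilbertSamuelEliminationSigmaMaxModificationsCorridor3WLadderRecognitionNearLocusKeys
import Literature.AlgebraicGeometry.CossartJannsenSaito2020.ProjDirProjectiveLineRegular
import Literature.AlgebraicGeometry.CossartJannsenSaito2020.NearPointProjDirectrix
import HarnessLib

/-!
# [OURS · L1 W4.2] RECOGNITION-GEOMETRY (R2), PART 5: THE FIRST STAGE `N_1(x) = ℙ(Dir_x)` AND THE UNIT-LEVEL `iso` CLAUSE FROM
# THE DATA OF CJS Def. 6.38 (ii)–(iii) (crux chain w42, line `w_ladder`; `--supports stmt-…-19249`, helper)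

OURS (cell res-hironaka, slot W4.2, seat res-L1-w42-stub-2 gen 4); NOT statements of H. Hironaka's manuscript [Hironaka2017]
nor of [CossartJannsenSaito2020]. AI-drafted, weaker than expert review. Sorry-free PROOF file (no new definition).

PARTS 1–4 analyse the near locus `N_{j+1}(x)` over a curve centre `C_j = N_j(x)` for `j ≥ 1`. This part supplies the FIRST stage and
the packaging in the exact data of CJS Def. 6.38 (the fields `centre_zero`, `centre_one`, `centre_near` of `IsFundamentalUnit` /
stub-1's `Seg.UnitCentreDiscipline`):

* `nearLocus_one_subset_projDir` — **`N_1(x) ⊆ ℙ(Dir_x(X_0))`** (CJS Thm. 3.14 for the point centre `C_0 = {x}`, locus form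
  `Thm314_point_locus`; p. 103 L17 «any point of `X_1` which is near to `x` lies in `C_1 = ℙ(Dir_x(X))`»);
* `nearLocus_one_eq_projDir` — **`N_1(x) = ℙ(Dir_x(X_0))`** as soon as `C_1 = ℙ(Dir_x)` is the (permissible) centre of `π_2`
  and `N_1(x)` is non-empty (`H` is constant along the permissible irreducible `C_1`; P-a `ProjDir_projLine_holds` for
  irreducibility);
* **`inducesIsoOn_of_unit`** — for a tower with `C_0 = {x}` (`x` closed, `e_x = 2`, `ē_x ≤ 2`, (F1), closed strata, `X_0`
  noetherian), `C_1 = ℙ(Dir_x)`, `C_q = N_q(x)` for `2 ≤ q ≤ m − 1`, `N_1(x) ≠ ∅`, and at every stage `2 ≤ i ≤ m − 1` a CLOSED near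
  point NOT isolated in `N_i(x)` (the marked point at a non-`Iso` stage): **`π_{j+1} : C_{j+1} ⥲ C_j` for all `1 ≤ j`,
  `j + 1 ≤ m − 1`** — i.e. the `iso` clause `∀ j, 1 ≤ j → j + 1 < m → InducesIsoOn (T.π j) (T.C (j+1)) … (T.C j) …` of Def. 6.38
  (iv), modulo the printed facts h314pt, h314, h314f, h36, h3104 only (P-a is DISCHARGED: `ProjDir_projLine_holds`, res-type-031);
* **`dich_and_regN_of_unit`** — under the same data, (Dich)/(RegN) for `N_{j+1}(x)` at every `1 ≤ j ≤ m − 1` (stub-1's (R5) inputs);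
* APPENDED: **`not_surjective_of_unit`** — CJS Def. 6.38 (v) (`¬ (C_{m−1} ⊆ π_m(N_m(x)))`) from the same data plus an ISOLATED closed
  near point at the terminal stage (the marked point at the closing `Iso` stage);
* APPENDED: `exists_not_isClosed_singleton_of_dominant`, **`dichPlus_nearLocus_succ`**, **`dichPlus_of_unit`** — (Dich⁺): the dominant
  branch as «irreducible ∧ nontrivial ∧ a non-closed point ∧ regular», the finite branch as «finite ∧ all points closed» (the input
  of `dichPlus_of_localize`, `…RecognitionNearLocusLocalize`).

## References

* V. Cossart, U. Jannsen, S. Saito, LNM 2270 (2020): Thm. 3.3, Thm. 3.14, Def. 6.34 (i), Def. 6.38 (ii)–(iv), p. 103, p. 104.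
  [CossartJannsenSaito2020]
-/

noncomputable section

-- namespace `…Corridor3.Helpers` re-enters `…Corridor3`
set_option linter.dupNamespace false

open CategoryTheory AlgebraicGeometry TopologicalSpace IsLocalRing
open Literature.AlgebraicGeometry.Resolution
open Scheme.IdealSheafData

universe u

open Literature.AlgebraicGeometry.CossartJannsenSaito2020

namespace Summit.ResolutionOfSingularities.ResolutionOfSingularities.Theorems.SigmaMaxModificationsCorridor3.Helpers

namespace BlowupTowerNear

variable {T : BlowupTower.{u}} {N : ℕ}

/-- **`N_1(x) ⊆ ℙ(Dir_x(X_0))`**: every point of `X_1` near to `x` lies on the projectivised directrix (CJS Thm. 3.14 for the point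
centre `{x}`, `Thm314_point_locus`). [cite: CossartJannsenSaito2020, Thm. 3.14, p. 103] -/
theorem nearLocus_one_subset_projDir (h314pt : Thm314_point_locus.{u}) (hkey : KeySetting T N)
    (hperm : ∀ j, IdealSheafData.IsPermissible (T.centreIdeal j)) {x : T.X 0} (hx : IsClosed ({x} : Set (T.X 0)))
    (hC0 : T.C 0 = {x}) (hchar : CharHypothesis (T.X 0) x) : T.nearLocus N x 1 ⊆ T.projDir x := by
  haveI : ∀ j, IsLocallyNoetherian (T.X j) := T.ln
  have hcl : (⟨T.C 0, T.isClosed_C 0⟩ : Closeds (T.X 0)) = ⟨{x}, hx⟩ := Closeds.ext hC0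
  have hbl : IsBlowup (T.π 0) (vanishingIdeal (⟨{x}, hx⟩ : Closeds (T.X 0))) := by
    have h := T.isBlowup 0
    rwa [hcl] at h
  have hp : IdealSheafData.IsPermissible (vanishingIdeal (⟨{x}, hx⟩ : Closeds (T.X 0))) := by
    have h := hperm 0
    rwa [BlowupTower.centreIdeal, hcl] at h
  intro ξ hξ
  rw [BlowupTower.mem_nearLocus, BlowupTower.phi_one] at hξ
  rw [BlowupTower.mem_projDir]
  exact ⟨hξ.1, h314pt (T.X 0) (T.X 1) (T.π 0) x hx N ξ hkey.excellent hp hbl hkey.dim_le hξ.1 hchar hξ.2⟩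

/-- **`N_1(x) = ℙ(Dir_x(X_0))` when `C_1 = ℙ(Dir_x)` is the centre of `π_2` and `N_1(x) ≠ ∅`** (`⊆` by Thm. 3.14; `⊇`: `H` is constant
along the permissible irreducible `C_1`, which contains a near point). [cite: CossartJannsenSaito2020, Thm. 3.14, Thm. 3.3, Def. 6.38 (ii)–(iii)] -/
theorem nearLocus_one_eq_projDir (h314pt : Thm314_point_locus.{u}) (hkey : KeySetting T N)
    (hperm : ∀ j, IdealSheafData.IsPermissible (T.centreIdeal j)) {x : T.X 0} (hx : IsClosed ({x} : Set (T.X 0)))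
    (hC0 : T.C 0 = {x}) (hchar : CharHypothesis (T.X 0) x) (he : T.dirDimAt 0 x = 2) (hC1 : T.C 1 = T.projDir x)
    (hN1 : (T.nearLocus N x 1).Nonempty) : T.nearLocus N x 1 = T.projDir x := by
  have hsub := nearLocus_one_subset_projDir h314pt hkey hperm hx hC0 hchar
  refine subset_antisymm hsub ?_
  obtain ⟨y₀, hy₀⟩ := hN1
  obtain ⟨-, hirr, -, -⟩ := curveData_projDir ProjDir_projLine_holds hx hC0 he
  rw [← hC1] at hirr ⊢
  refine centre_subset_nearLocus_of_isPermissible T hkey hperm hirr ?_ (hC1 ▸ hsub hy₀) hy₀.2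
  intro z hz
  rw [hC1, BlowupTower.mem_projDir] at hz
  show (T.phi 1).base z = x
  rw [BlowupTower.phi_one]; exact hz.1

/-- The centres ARE the near loci at all stages `1 ≤ i ≤ q` once `C_1 = ℙ(Dir_x)` (with `N_1(x) ≠ ∅`) and `C_i = N_i(x)` for
`2 ≤ i ≤ q`. [cite: CossartJannsenSaito2020, Def. 6.38 (ii)–(iii)] -/
theorem centres_eq_nearLocus_of_unit (h314pt : Thm314_point_locus.{u}) (hkey : KeySetting T N)
    (hperm : ∀ j, IdealSheafData.IsPermissible (T.centreIdeal j)) {x : T.X 0} (hx : IsClosed ({x} : Set (T.X 0)))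
    (hC0 : T.C 0 = {x}) (hchar : CharHypothesis (T.X 0) x) (he : T.dirDimAt 0 x = 2) (hC1 : T.C 1 = T.projDir x)
    (hN1 : (T.nearLocus N x 1).Nonempty) {q : ℕ} (hCq : ∀ i, 2 ≤ i → i ≤ q → T.C i = T.nearLocus N x i) :
    ∀ i, 1 ≤ i → i ≤ q → T.C i = T.nearLocus N x i := by
  intro i hi hiq
  rcases Nat.lt_or_ge i 2 with h | h
  · obtain rfl : i = 1 := by omega
    rw [hC1, nearLocus_one_eq_projDir h314pt hkey hperm hx hC0 hchar he hC1 hN1]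
  · exact hCq i h hiq

/-- **CJS Def. 6.38 (iv) FROM THE DATA OF (ii)–(iii): `π_{j+1} : C_{j+1} ⥲ C_j` for all `1 ≤ j`, `j + 1 ≤ q`**, for a tower with
`C_0 = {x}` (`x` closed, `e_x = 2`, `ē_x ≤ 2`, (F1)), `C_1 = ℙ(Dir_x)`, `N_1(x) ≠ ∅`, `C_i = N_i(x)` (`2 ≤ i ≤ q`) and, at every stage
`2 ≤ i ≤ q`, a closed near point NOT isolated in `N_i(x)` — modulo the printed facts h314pt, h314, h314f, h36, h3104 only. With
`q = m − 1` this is the `iso` clause of `IsFundamentalUnit T N m x x'` / `Seg.UnitCentreDiscipline T N m x`.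
[cite: CossartJannsenSaito2020, Def. 6.38 (ii)–(iv), p. 104] -/
theorem inducesIsoOn_of_unit [IsNoetherian (T.X 0)] (h314pt : Thm314_point_locus.{u})
    (h314 : CossartJannsenSaito2020_thm_3_14.{u}) (h314f : Thm314_nearFibre_subsingleton.{u})
    (h36 : CossartJannsenSaito2020_thm_3_6.{u}) (h3104 : CossartJannsenSaito2020_thm_3_10_4.{u}) (hkey : KeySetting T N)
    (hperm : ∀ j, IdealSheafData.IsPermissible (T.centreIdeal j))
    (hcl : ∀ (j : ℕ) (μ : ℕ → ℕ), IsClosed (Scheme.hsStratumGE (T.X j) N μ))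
    {x : T.X 0} (hx : IsClosed ({x} : Set (T.X 0))) (hchar : CharHypothesis (T.X 0) x) (he : T.dirDimAt 0 x = 2)
    (hē : T.geomDirDimAt 0 x ≤ 2) (hC0 : T.C 0 = {x}) (hC1 : T.C 1 = T.projDir x) (hN1 : (T.nearLocus N x 1).Nonempty)
    {q : ℕ} (hCq : ∀ i, 2 ≤ i → i ≤ q → T.C i = T.nearLocus N x i)
    (hniso : ∀ i, 2 ≤ i → i ≤ q → ∃ z ∈ T.nearLocus N x i, IsClosed ({z} : Set (T.X i)) ∧
      ¬ ∃ U : Set (T.X i), IsOpen U ∧ U ∩ T.nearLocus N x i = {z}) :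
    ∀ j, 1 ≤ j → j + 1 ≤ q → InducesIsoOn (T.π j) (T.C (j + 1)) (T.isClosed_C (j + 1)) (T.C j) (T.isClosed_C j) :=
  inducesIsoOn_of_centres_eq_nearLocus_projDir ProjDir_projLine_holds h314pt h314 h314f h36 h3104 hkey hperm hcl hx hchar he hē
    hC0 hC1 (centres_eq_nearLocus_of_unit h314pt hkey hperm hx hC0 hchar he hC1 hN1 hCq) hniso

/-- **(Dich)/(RegN) FROM THE DATA OF Def. 6.38 (ii)–(iii)** at every stage `1 ≤ j ≤ q` (same hypotheses as `inducesIsoOn_of_unit`):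
`N_{j+1}(x)` is irreducible or finite, and regular if infinite — stub-1's (R5)/(H-emp) inputs at stage `j + 1`.
[cite: CossartJannsenSaito2020, Def. 6.38 (iii)–(iv), p. 94, p. 104] -/
theorem dich_and_regN_of_unit [IsNoetherian (T.X 0)] (h314pt : Thm314_point_locus.{u})
    (h314 : CossartJannsenSaito2020_thm_3_14.{u}) (h314f : Thm314_nearFibre_subsingleton.{u})
    (h36 : CossartJannsenSaito2020_thm_3_6.{u}) (h3104 : CossartJannsenSaito2020_thm_3_10_4.{u}) (hkey : KeySetting T N)
    (hperm : ∀ j, IdealSheafData.IsPermissible (T.centreIdeal j))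
    (hcl : ∀ (j : ℕ) (μ : ℕ → ℕ), IsClosed (Scheme.hsStratumGE (T.X j) N μ))
    {x : T.X 0} (hx : IsClosed ({x} : Set (T.X 0))) (hchar : CharHypothesis (T.X 0) x) (he : T.dirDimAt 0 x = 2)
    (hē : T.geomDirDimAt 0 x ≤ 2) (hC0 : T.C 0 = {x}) (hC1 : T.C 1 = T.projDir x) (hN1 : (T.nearLocus N x 1).Nonempty)
    {q : ℕ} (hCq : ∀ i, 2 ≤ i → i ≤ q → T.C i = T.nearLocus N x i)
    (hniso : ∀ i, 2 ≤ i → i ≤ q → ∃ z ∈ T.nearLocus N x i, IsClosed ({z} : Set (T.X i)) ∧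
      ¬ ∃ U : Set (T.X i), IsOpen U ∧ U ∩ T.nearLocus N x i = {z})
    {j : ℕ} (hj : 1 ≤ j) (hjq : j ≤ q) :
    (IsIrreducible (T.nearLocus N x (j + 1)) ∨ (T.nearLocus N x (j + 1)).Finite) ∧
      ∀ (hN : IsClosed (T.nearLocus N x (j + 1))), (T.nearLocus N x (j + 1)).Infinite →
        Scheme.IsRegular (vanishingIdeal (⟨T.nearLocus N x (j + 1), hN⟩ : Closeds (T.X (j + 1)))).subscheme :=
  dich_and_regN_of_centres_eq_nearLocus_projDir ProjDir_projLine_holds h314pt h314 h314f h36 h3104 hkey hperm hcl hx hchar he hē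
    hC0 hC1 (centres_eq_nearLocus_of_unit h314pt hkey hperm hx hC0 hchar he hC1 hN1 hCq) hniso hj hjq

/-! ## Appended (gen 4): CJS Def. 6.38 (v) at the END of the unit from the same data -/

/-- **CJS Def. 6.38 (v) FROM THE DATA OF (ii)–(iii): `π_m : C_m → C_{m−1}` is NOT surjective**, i.e.
`¬ (C_{m−1} ⊆ π_m(N_m(x)))` with `m = q + 1`, for a tower with `C_0 = {x}` (`x` closed, `e_x = 2`, `ē_x ≤ 2`, (F1)), `C_1 = ℙ(Dir_x)`,
`N_1(x) ≠ ∅`, `C_i = N_i(x)` (`2 ≤ i ≤ q`), a non-isolated closed near point at every stage `2 ≤ i ≤ q`, and at stage `q + 1` a CLOSED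
near point ISOLATED in `N_{q+1}(x)` (the marked point at the terminal `Iso` stage) — the `not_surjective` clause of `IsFundamentalUnit` /
`Seg.UnitCentreDiscipline` (`j = q`, `m = q + 1`), printed facts only (cf. res-D-pv-038's kernel
`Helpers.not_subset_image_of_isolated_of_fibre_subsingleton`, p519222, for the same step from isolation).
[cite: CossartJannsenSaito2020, Def. 6.38 (v), p. 105] -/
theorem not_surjective_of_unit [IsNoetherian (T.X 0)] (h314pt : Thm314_point_locus.{u})
    (h314f : Thm314_nearFibre_subsingleton.{u}) (h36 : CossartJannsenSaito2020_thm_3_6.{u})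
    (h3104 : CossartJannsenSaito2020_thm_3_10_4.{u}) (hkey : KeySetting T N)
    (hperm : ∀ j, IdealSheafData.IsPermissible (T.centreIdeal j))
    (hcl : ∀ (j : ℕ) (μ : ℕ → ℕ), IsClosed (Scheme.hsStratumGE (T.X j) N μ))
    {x : T.X 0} (hx : IsClosed ({x} : Set (T.X 0))) (hchar : CharHypothesis (T.X 0) x) (he : T.dirDimAt 0 x = 2)
    (hē : T.geomDirDimAt 0 x ≤ 2) (hC0 : T.C 0 = {x}) (hC1 : T.C 1 = T.projDir x) (hN1 : (T.nearLocus N x 1).Nonempty)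
    {q : ℕ} (hq : 1 ≤ q) (hCq : ∀ i, 2 ≤ i → i ≤ q → T.C i = T.nearLocus N x i)
    (hniso : ∀ i, 2 ≤ i → i ≤ q → ∃ z ∈ T.nearLocus N x i, IsClosed ({z} : Set (T.X i)) ∧
      ¬ ∃ U : Set (T.X i), IsOpen U ∧ U ∩ T.nearLocus N x i = {z})
    {z : T.X (q + 1)} (hzcl : IsClosed ({z} : Set (T.X (q + 1))))
    (hiso : ∃ U : Set (T.X (q + 1)), IsOpen U ∧ U ∩ T.nearLocus N x (q + 1) = {z}) :
    ¬ (T.C q ⊆ (T.π q).base '' T.nearLocus N x (q + 1)) := by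
  have hCq' := centres_eq_nearLocus_of_unit h314pt hkey hperm hx hC0 hchar he hC1 hN1 hCq
  obtain ⟨-, h1irr, h1nt, h1pts⟩ := curveData_projDir ProjDir_projLine_holds hx hC0 he
  rw [← hC1] at h1irr h1nt h1pts
  have hNC : ∀ k, k ≤ q → T.nearLocus N x k ⊆ T.C k := by
    intro k hk
    rcases Nat.eq_zero_or_pos k with rfl | hpos
    · rw [BlowupTower.nearLocus_zero, hC0]
    · exact (hCq' k hpos hk).symm.subset
  obtain ⟨hirr, hnt, hpts⟩ := curveData_of_centres_eq_nearLocus h314f h36 h3104 hkey hperm hcl hx hchar hē hC0 hCq' h1irr h1nt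
    (fun y hy hgy => h1pts y hy hgy) hniso q hq le_rfl
  exact not_subset_image_nearLocus_succ_of_isolated_closed h314f h36 h3104 hkey hperm hcl hx hchar hē hNC (hCq' q hq le_rfl).subset
    hirr hnt hpts hzcl hiso

/-! ## Appended (gen 4): (Dich⁺) — the dominant branch with nontriviality, a NON-CLOSED point and regularity bundled -/

/-- **In the dominant case the generic point of `N_{j+1}(x)` is NOT a closed point** (`N_{j+1}(x)` is nontrivial and equals the
closure of its generic point). [cite: CossartJannsenSaito2020, p. 104] -/
theorem exists_not_isClosed_singleton_of_dominant (h314f : Thm314_nearFibre_subsingleton.{u})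
    (hT36 : CossartJannsenSaito2020_thm_3_6.{u})
    (h3104 : CossartJannsenSaito2020_thm_3_10_4.{u}) (hkey : KeySetting T N)
    (hperm : ∀ j, IdealSheafData.IsPermissible (T.centreIdeal j))
    (hcl : ∀ (j : ℕ) (μ : ℕ → ℕ), IsClosed (Scheme.hsStratumGE (T.X j) N μ))
    {x : T.X 0} (hx : IsClosed ({x} : Set (T.X 0))) (hchar : CharHypothesis (T.X 0) x) (hē : T.geomDirDimAt 0 x ≤ 2)
    {j : ℕ}
    (hNC : ∀ i, i ≤ j → T.nearLocus N x i ⊆ T.C i) (hCN : T.C j ⊆ T.nearLocus N x j)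
    (hirr : IsIrreducible (T.C j)) (hnt : (T.C j).Nontrivial)
    (hpts : ∀ y ∈ T.C j, ¬ IsGenericPoint y (T.C j) → IsClosed ({y} : Set (T.X j)))
    {η : T.X j} (hη : IsGenericPoint η (T.C j)) (hdom : η ∈ (T.π j).base '' T.nearLocus N x (j + 1)) :
    ∃ z ∈ T.nearLocus N x (j + 1), ¬ IsClosed ({z} : Set (T.X (j + 1))) := by
  have hirr' := isIrreducible_nearLocus_succ_of_dominant h314f hT36 h3104 hkey hperm hcl hx hchar hē hNC hCN hirr hnt hpts hη hdom
  have hnt' := nontrivial_nearLocus_succ_of_dominant h314f hT36 h3104 hkey hperm hcl hx hchar hē hNC hCN hirr hnt hpts hη hdom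
  have hζ : IsGenericPoint hirr'.genericPoint (T.nearLocus N x (j + 1)) :=
    hirr'.isGenericPoint_genericPoint (isClosed_nearLocus T hkey hperm hcl hx (j + 1))
  refine ⟨hirr'.genericPoint, hζ.mem, fun hcl' => ?_⟩
  obtain ⟨w, hw, hne⟩ := hnt'.exists_ne hirr'.genericPoint
  have h1 : closure {hirr'.genericPoint} = T.nearLocus N x (j + 1) := hζ.def
  rw [hcl'.closure_eq] at h1
  exact hne (by rw [← h1] at hw; exact hw)

/-- **(Dich⁺) at one step, KEYED**: `N_{j+1}(x)` is EITHER irreducible, nontrivial, with a non-closed point, and regular (reduced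
structure), OR a finite set of closed points — the input shape of `dichPlus_of_localize` (`…RecognitionNearLocusLocalize`), printed
facts only. [cite: CossartJannsenSaito2020, p. 94, p. 104] -/
theorem dichPlus_nearLocus_succ [IsNoetherian (T.X 0)] (h314pt : Thm314_point_locus.{u})
    (h314 : CossartJannsenSaito2020_thm_3_14.{u}) (h314f : Thm314_nearFibre_subsingleton.{u})
    (hT36 : CossartJannsenSaito2020_thm_3_6.{u})
    (h3104 : CossartJannsenSaito2020_thm_3_10_4.{u}) (hkey : KeySetting T N)
    (hperm : ∀ j, IdealSheafData.IsPermissible (T.centreIdeal j))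
    (hcl : ∀ (j : ℕ) (μ : ℕ → ℕ), IsClosed (Scheme.hsStratumGE (T.X j) N μ))
    {x : T.X 0} (hx : IsClosed ({x} : Set (T.X 0))) (hchar : CharHypothesis (T.X 0) x) (hē : T.geomDirDimAt 0 x ≤ 2)
    {j : ℕ}
    (hNC : ∀ i, i ≤ j → T.nearLocus N x i ⊆ T.C i) (hCN : T.C j ⊆ T.nearLocus N x j)
    (hirr : IsIrreducible (T.C j)) (hnt : (T.C j).Nontrivial)
    (hpts : ∀ y ∈ T.C j, ¬ IsGenericPoint y (T.C j) → IsClosed ({y} : Set (T.X j))) :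
    (IsIrreducible (T.nearLocus N x (j + 1)) ∧ (T.nearLocus N x (j + 1)).Nontrivial ∧
        (∃ z ∈ T.nearLocus N x (j + 1), ¬ IsClosed ({z} : Set (T.X (j + 1)))) ∧
        ∀ hN : IsClosed (T.nearLocus N x (j + 1)),
          Scheme.IsRegular (vanishingIdeal (⟨T.nearLocus N x (j + 1), hN⟩ : Closeds (T.X (j + 1)))).subscheme) ∨
      ((T.nearLocus N x (j + 1)).Finite ∧ ∀ z ∈ T.nearLocus N x (j + 1), IsClosed ({z} : Set (T.X (j + 1)))) := by
  have hη : IsGenericPoint hirr.genericPoint (T.C j) := hirr.isGenericPoint_genericPoint (T.isClosed_C j)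
  by_cases hdom : hirr.genericPoint ∈ (T.π j).base '' T.nearLocus N x (j + 1)
  · exact Or.inl ⟨isIrreducible_nearLocus_succ_of_dominant h314f hT36 h3104 hkey hperm hcl hx hchar hē hNC hCN hirr hnt hpts hη hdom, nontrivial_nearLocus_succ_of_dominant h314f hT36 h3104 hkey hperm hcl hx hchar hē hNC hCN hirr hnt hpts hη hdom,
      exists_not_isClosed_singleton_of_dominant h314f hT36 h3104 hkey hperm hcl hx hchar hē hNC hCN hirr hnt hpts hη hdom,
      fun hN => isRegular_nearLocus_succ_of_dominant (CampaignW42.isIso_residueFieldMap_of_near_of_charHypothesis h314pt) h314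
        h314f hT36 h3104 hkey hperm hcl hx hchar hē hNC hCN hirr hnt hpts hη hdom hN⟩
  · exact Or.inr ⟨finite_nearLocus_succ_of_not_dominant h314f hT36 h3104 hkey hperm hcl hx hchar hē hNC hCN hirr hnt hpts hη hdom,
      isClosed_singleton_of_mem_nearLocus_succ_of_not_dominant h314f hT36 h3104 hkey hperm hcl hx hchar hē hNC hCN hirr hnt hpts hη hdom⟩

/-- **(Dich⁺) FROM THE DATA OF Def. 6.38 (ii)–(iii)** at every stage `1 ≤ j ≤ q` (hypotheses of `inducesIsoOn_of_unit`): the input of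
`dichPlus_of_localize`, i.e. — after res-type-053's localisation and the transfer of `…RecognitionNearLocusLocalize` — stub-1's
(Dich)/(RegN) on the global stages. [cite: CossartJannsenSaito2020, Def. 6.38 (iii)–(iv), p. 94, p. 104] -/
theorem dichPlus_of_unit [IsNoetherian (T.X 0)] (h314pt : Thm314_point_locus.{u})
    (h314 : CossartJannsenSaito2020_thm_3_14.{u}) (h314f : Thm314_nearFibre_subsingleton.{u})
    (h36 : CossartJannsenSaito2020_thm_3_6.{u}) (h3104 : CossartJannsenSaito2020_thm_3_10_4.{u}) (hkey : KeySetting T N)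
    (hperm : ∀ j, IdealSheafData.IsPermissible (T.centreIdeal j))
    (hcl : ∀ (j : ℕ) (μ : ℕ → ℕ), IsClosed (Scheme.hsStratumGE (T.X j) N μ))
    {x : T.X 0} (hx : IsClosed ({x} : Set (T.X 0))) (hchar : CharHypothesis (T.X 0) x) (he : T.dirDimAt 0 x = 2)
    (hē : T.geomDirDimAt 0 x ≤ 2) (hC0 : T.C 0 = {x}) (hC1 : T.C 1 = T.projDir x) (hN1 : (T.nearLocus N x 1).Nonempty)
    {q : ℕ} (hCq : ∀ i, 2 ≤ i → i ≤ q → T.C i = T.nearLocus N x i)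
    (hniso : ∀ i, 2 ≤ i → i ≤ q → ∃ z ∈ T.nearLocus N x i, IsClosed ({z} : Set (T.X i)) ∧
      ¬ ∃ U : Set (T.X i), IsOpen U ∧ U ∩ T.nearLocus N x i = {z})
    {j : ℕ} (hj : 1 ≤ j) (hjq : j ≤ q) :
    (IsIrreducible (T.nearLocus N x (j + 1)) ∧ (T.nearLocus N x (j + 1)).Nontrivial ∧
        (∃ z ∈ T.nearLocus N x (j + 1), ¬ IsClosed ({z} : Set (T.X (j + 1)))) ∧
        ∀ hN : IsClosed (T.nearLocus N x (j + 1)),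
          Scheme.IsRegular (vanishingIdeal (⟨T.nearLocus N x (j + 1), hN⟩ : Closeds (T.X (j + 1)))).subscheme) ∨
      ((T.nearLocus N x (j + 1)).Finite ∧ ∀ z ∈ T.nearLocus N x (j + 1), IsClosed ({z} : Set (T.X (j + 1)))) := by
  have hCq' := centres_eq_nearLocus_of_unit h314pt hkey hperm hx hC0 hchar he hC1 hN1 hCq
  obtain ⟨-, h1irr, h1nt, h1pts⟩ := curveData_projDir ProjDir_projLine_holds hx hC0 he
  rw [← hC1] at h1irr h1nt h1pts
  have hNC : ∀ k, k ≤ j → T.nearLocus N x k ⊆ T.C k := by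
    intro k hk
    rcases Nat.eq_zero_or_pos k with rfl | hpos
    · rw [BlowupTower.nearLocus_zero, hC0]
    · exact (hCq' k hpos (by omega)).symm.subset
  obtain ⟨hirr, hnt, hpts⟩ := curveData_of_centres_eq_nearLocus h314f h36 h3104 hkey hperm hcl hx hchar hē hC0 hCq' h1irr h1nt
    (fun y hy hgy => h1pts y hy hgy) hniso j hj hjq
  exact dichPlus_nearLocus_succ h314pt h314 h314f h36 h3104 hkey hperm hcl hx hchar hē hNC (hCq' j hj hjq).subset hirr hnt hpts

end BlowupTowerNear

end Summit.ResolutionOfSingularities.ResolutionOfSingularities.Theorems.SigmaMaxModificationsCorridor3.Helpers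

end
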